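import Literature.Analysis.FluidPDE.PassiveVectorTensorGarding
import Literature.Analysis.FluidPDE.PassiveVectorVarTensorGarding
import Literature.Analysis.FluidPDE.PassiveVectorTensorDistortedTwistedCoercivity
import Literature.Analysis.FluidPDE.PassiveVectorTensorDistortedTransverseInvariance
import Literature.Analysis.FunctionSpaces.TorusSpectralWeakDerivative
import Literature.Analysis.FunctionSpaces.TorusScalarTrigPoly
import HarnessLib

/-!
# Gårding's inequality WITH DIVERGENCE for a constant Legendre–Hadamard tensor, and the twisted
# Gårding inequality on `G`-solenoidal fields (`∇·(G ψ) = 0`, `G` near the identity)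

Analysis/FluidPDE proof-support file (everything proved; no definitions, no named facts).

The tree's `integral_inner_viscAdj_self_le` (`PassiveVectorTensorGarding`) is Gårding's inequality
`∫⟪ψ, 𝓛_𝔸^* ψ⟫ ≤ −lo‖∇ψ‖₂²` for a constant tensor in a Legendre–Hadamard (TRANSVERSE) window
`NearIso 𝔸 lo hi` on DIVERGENCE-FREE fields: the Fourier modes of a divergence-free field are transversal,
and the window only controls transversal amplitudes.  Fields satisfying the DISTORTED constraint
`∇·(G ψ) = 0` of the Lagrangian-coordinate class `IsWeakTensorPassiveVectorDistortedOn` (frame `G` entrywise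
`θ`-close to the identity, divergence-free columns — Armstrong–Vicol's Piola structure, §4.1) are NOT
divergence free; this file supplies the corrected inequalities, with explicit constants:

* §1 MODEWISE (Giaquinta Ch. III §2: rank-one coercivity (2.2) ⇒ Gårding (2.6), longitudinal part kept):
  for `NearIso 𝔸 lo hi` AND a full bound `FullBound 𝔸 h`, every `η > 0`, every wave vector `k` and EVERY
  amplitude, real `symb_ge_of_nearIso_fullBound`
  `(lo − η)|k|²|x|² − (lo − η + h + h²/η)(k·x)² ≤ symb 𝔸 k x`
  and complex `re_inner_symbT_ge_of_nearIso_fullBound` (split `x = p + q`, `p ⊥ k`, window on `(p,p)`,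
  `abs_bsymb_le_of_fullBound` on the other pairs, Young); `fullBound_majorTranspose`.
* §2 the divergence on the Fourier side: `mFourierCoeff_ofReal_divergence` (`(∇·ψ)^(k) = 2πi Σ_j k_j ψ̂_j(k)`),
  `hasSum_sq_divergence` (Parseval `Σ_k 4π²|k·ψ̂(k)|² = ∫(∇·ψ)²`), `sum_sq_divergence_le` (Bessel).
* §3 **GÅRDING WITH DIVERGENCE** `integral_inner_viscAdj_self_le_add_sq_divergence`: for `0 < η ≤ lo` and
  every smooth `ψ`,
  `∫⟪ψ, 𝓛_𝔸^* ψ⟫ ≤ −(lo − η)‖∇ψ‖₂² + (lo − η + h + h²/η) ∫(∇·ψ)²`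
  (truncations `∫⟪P_Nψ, 𝓛_𝔸^*ψ⟫ = −4π² Σ_{|k|≤N} Re⟪ψ̂, T_{𝔸ᵀ}ψ̂⟫`, §1 modewise, Bessel, `N → ∞`).
* §4 `G`-SOLENOIDAL FIELDS: by test-side Piola (`sum_mul_partialDeriv_eq_zero_of_isDivFree_distort`)
  `∇·ψ = −(G − 1):∇ψ` (`divergence_eq_neg_sum_of_isDivFree_distort`), hence
  `∫(∇·ψ)² ≤ (card d · θ)² ‖∇ψ‖₂²` (`integral_sq_divergence_le_of_isDivFree_distort`) and the flat Gårding
  inequality on `G`-solenoidal fields `integral_inner_viscAdj_self_le_of_isDivFree_distort`: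
  `∫⟪ψ, 𝓛_𝔸^* ψ⟫ ≤ −(lo − η − (lo − η + h + h²/η)(dθ)²)‖∇ψ‖₂²`.
* §5 **THE TWISTED GÅRDING INEQUALITY** `integral_inner_viscAdjVar_conj_self_le_of_isDivFree_distort`: with
  the conjugated tensor field `y ↦ 𝔸^{G(y)}` (`viscAdjVar`),
  `∫⟪ψ, 𝓛^{G,*}_𝔸 ψ⟫ ≤ −(lo − η − (lo − η + h + h²/η)(dθ)² − h(2dθ + (dθ)²))‖∇ψ‖₂²`
  (energy-form identity `integral_inner_viscAdjVar_self_eq_neg_gradForm` + the integrated pointwise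
  comparison `integral_gradForm_sub_le_integral_gradForm_conj` from `abs_gradForm_conj_sub_le`).
  This is the «Helmholtz-corrected floor» (E2′) making the twisted coercivity (E2,
  `PassiveVectorTensorDistortedTwistedCoercivity`) usable with Legendre–Hadamard (`NearIso`) tensors.

Consumer: cell `ad-ideate`, K1L_D `stmt-AnomalousDissipation-27980`, WANTED #3 (E2′) (tenure ruling
2026-08-29T14:41:39Z), (S2) rows of `ad-k1loc-p3`.

## Mathlib / tree search
Tree: `integral_inner_fourierTruncate_viscAdj_eq`, `integral_inner_viscAdj_self_le` (`PassiveVectorTensorGarding`),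
`re_inner_symbT_eq`, `lo_mul_le_re_inner_symbT` (`PassiveVectorTensorUniqueness`), `bsymb`, `symb`, `NearIso`,
`majorTranspose`, `nearIso_majorTranspose_iff` (`PassiveVectorTensor`), `FullBound`, `gradForm_isoVisc`
(`PassiveVectorTensorTransverseKernel`), `integral_inner_viscAdjVar_self_eq_neg_gradForm`,
`gradNormSq_eq_integral_sum_sum_sq` (`PassiveVectorVarTensorGarding`), `abs_gradForm_conj_sub_le`
(`PassiveVectorTensorDistortedTwistedCoercivity`), `sum_mul_partialDeriv_eq_zero_of_isDivFree_distort`,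
`isSmooth_conj_entry` (`PassiveVectorTensorDistortedTransverseInvariance`), `mFourierCoeff_partialDeriv`,
`mFourierCoeff_finset_sum`, `hasSum_sq_norm_mFourierCoeff_ofReal`, `partialDeriv_ofReal_comp`,
`toReal_eGradNormSq_realTrigPoly`, `tendsto_gradNormSq_fourierTruncate`. Mathlib: `sum_le_hasSum`,
`sq_sum_le_card_mul_sum_sq`, `le_of_tendsto_of_tendsto'`.

## References
* M. Giaquinta, *Multiple integrals in the calculus of variations and nonlinear elliptic systems*
  (Princeton 1983), Ch. III §2 (2.1)–(2.6). [`Giaquinta1983MultipleIntegrals`]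
* L. Grafakos, *Classical Fourier Analysis*, 3rd ed. (2014), Prop. 3.2.6 (8), Prop. 3.2.7 (3). [`Grafakos2014`]
* S. Armstrong, V. Vicol, *Anomalous diffusion by fractal homogenization*, Ann. PDE (2025), §4.1, PDF p. 34.
  [`ArmstrongVicol2025`]
* U. Frisch, *Turbulence* (CUP 1995), §9.6.3 eq. (9.57) p. 233. [`Frisch1995Turbulence`]
* L. C. Evans, *Partial Differential Equations*, 2nd ed. (2010), §8.1.4.b (Piola / null Lagrangians). [`Evans2010`]
-/

noncomputable section

open MeasureTheory Set Filter Function TopologicalSpace Complex UnitAddTorus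
open scoped ENNReal NNReal InnerProductSpace ComplexConjugate Topology

namespace Literature.Analysis.FluidPDE

namespace Torus

variable {d : Type*} [Fintype d] [DecidableEq d]

/-! ## §1 The modewise inequality: Legendre–Hadamard window + full bound, any (non-transverse) amplitude -/

section Modewise

omit [DecidableEq d] in
/-- The bilinear symbol is additive in the middle slot. [cite: Giaquinta1983MultipleIntegrals, Ch. III §2 eq. (2.3)] -/
theorem bsymb_add_mid (𝔸 : Visc4 d) (k p p' q : d → ℝ) :
    bsymb 𝔸 k (fun i => p i + p' i) q = bsymb 𝔸 k p q + bsymb 𝔸 k p' q := by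
  simp only [bsymb, add_mul, mul_add, Finset.sum_add_distrib]

omit [DecidableEq d] in
/-- The bilinear symbol is additive in the last slot. [cite: Giaquinta1983MultipleIntegrals, Ch. III §2 eq. (2.3)] -/
theorem bsymb_add_right' (𝔸 : Visc4 d) (k p q q' : d → ℝ) :
    bsymb 𝔸 k p (fun j => q j + q' j) = bsymb 𝔸 k p q + bsymb 𝔸 k p q' := by
  simp only [bsymb, add_mul, mul_add, Finset.sum_add_distrib]

/-- **The full bound controls the bilinear symbol on ALL pairs**: `|bsymb 𝔸 k p q| ≤ h |k|² |p| |q|`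
(`FullBound` on the rank-one matrices `p ⊗ k`, `q ⊗ k`). [cite: Giaquinta1983MultipleIntegrals, Ch. III §2 eq. (2.1)] -/
theorem abs_bsymb_le_of_fullBound {𝔸 : Visc4 d} {h : ℝ} (hB : FullBound 𝔸 h) (k p q : d → ℝ) :
    |bsymb 𝔸 k p q| ≤ h * (∑ a, k a ^ 2) * (Real.sqrt (∑ i, p i ^ 2) * Real.sqrt (∑ i, q i ^ 2)) := by
  have h1 := hB (fun i a => p i * k a) (fun j b => q j * k b)
  have e0 : bsymb 𝔸 k p q = ∑ i, ∑ a, ∑ j, ∑ b, 𝔸 i a j b * (p i * k a) * (q j * k b) := by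
    simp only [bsymb]
    exact Finset.sum_congr rfl fun i _ => Finset.sum_congr rfl fun a _ => Finset.sum_congr rfl fun j _ =>
      Finset.sum_congr rfl fun b _ => by ring
  have eF : ∀ u : d → ℝ, gradForm (isoVisc 1 : Visc4 d) (fun i a => u i * k a) = (∑ i, u i ^ 2) * ∑ a, k a ^ 2 := by
    intro u
    rw [gradForm_isoVisc, one_mul, Finset.sum_mul]
    exact Finset.sum_congr rfl fun i _ => by rw [Finset.mul_sum]; exact Finset.sum_congr rfl fun a _ => by ring
  rw [e0]
  refine h1.trans (le_of_eq ?_)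
  rw [eF, eF, Real.sqrt_mul (Finset.sum_nonneg fun _ _ => sq_nonneg _),
    Real.sqrt_mul (Finset.sum_nonneg fun _ _ => sq_nonneg _)]
  have hk : Real.sqrt (∑ a, k a ^ 2) * Real.sqrt (∑ a, k a ^ 2) = ∑ a, k a ^ 2 :=
    Real.mul_self_sqrt (Finset.sum_nonneg fun _ _ => sq_nonneg _)
  calc h * (Real.sqrt (∑ i, p i ^ 2) * Real.sqrt (∑ a, k a ^ 2)) * (Real.sqrt (∑ i, q i ^ 2) * Real.sqrt (∑ a, k a ^ 2))
      = h * (Real.sqrt (∑ a, k a ^ 2) * Real.sqrt (∑ a, k a ^ 2)) * (Real.sqrt (∑ i, p i ^ 2) * Real.sqrt (∑ i, q i ^ 2)) := by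
        ring
    _ = h * (∑ a, k a ^ 2) * (Real.sqrt (∑ i, p i ^ 2) * Real.sqrt (∑ i, q i ^ 2)) := by rw [hk]

/-- **The modewise Gårding inequality with divergence (real amplitudes).**  For a tensor in a
Legendre–Hadamard window `NearIso 𝔸 lo hi` with full bound `FullBound 𝔸 h` and every `η > 0`,
`(lo − η)|k|²|x|² − (lo − η + h + h²/η)(k·x)² ≤ symb 𝔸 k x` for ALL amplitudes `x` (not only `x ⊥ k`):
split `x = p + q`, `q = ((k·x)/|k|²) k`, `p ⊥ k`, use the window on `(p,p)`, the full bound on the three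
other pairs and Young. (Giaquinta: rank-one coercivity (2.2) ⇒ Gårding (2.6); the divergence is the
longitudinal part.) [cite: Giaquinta1983MultipleIntegrals, Ch. III §2 eq. (2.2)–(2.6)] -/
theorem symb_ge_of_nearIso_fullBound {𝔸 : Visc4 d} {lo hi h η : ℝ} (hN : NearIso 𝔸 lo hi) (hB : FullBound 𝔸 h)
    (hη : 0 < η) (k x : d → ℝ) :
    (lo - η) * ((∑ a, k a ^ 2) * ∑ i, x i ^ 2) - (lo - η + h + h ^ 2 / η) * (∑ i, x i * k i) ^ 2 ≤ symb 𝔸 k x := by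
  set K2 : ℝ := ∑ a, k a ^ 2 with hK2
  set s : ℝ := ∑ i, x i * k i with hs
  have hK2nn : 0 ≤ K2 := Finset.sum_nonneg fun _ _ => sq_nonneg _
  by_cases hK0 : K2 = 0
  · -- `k = 0`: everything vanishes
    have hk : ∀ a, k a = 0 := fun a => by
      have := (Finset.sum_eq_zero_iff_of_nonneg fun a _ => sq_nonneg (k a)).1 hK0 a (Finset.mem_univ a)
      exact pow_eq_zero_iff (two_ne_zero) |>.1 this
    have hs0 : s = 0 := by rw [hs]; exact Finset.sum_eq_zero fun i _ => by rw [hk i, mul_zero]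
    have hsymb : symb 𝔸 k x = 0 := by
      unfold symb
      exact Finset.sum_eq_zero fun i _ => Finset.sum_eq_zero fun a _ => Finset.sum_eq_zero fun j _ =>
        Finset.sum_eq_zero fun b _ => by rw [hk a]; ring
    rw [hK0, hs0, hsymb]; ring_nf; rfl
  have hK2pos : 0 < K2 := lt_of_le_of_ne hK2nn (Ne.symm hK0)
  -- the splitting
  set q : d → ℝ := fun i => (s / K2) * k i with hq
  set p : d → ℝ := fun i => x i - q i with hp
  have hxpq : x = fun i => p i + q i := funext fun i => by simp [hp]
  have hptrans : ∑ i, p i * k i = 0 := by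
    have e : ∑ i, p i * k i = s - (s / K2) * K2 := by
      rw [hs, hK2, Finset.mul_sum, ← Finset.sum_sub_distrib]
      exact Finset.sum_congr rfl fun i _ => by simp [hp, hq]; ring
    rw [e]; field_simp; ring
  have hQ : ∑ i, q i ^ 2 = s ^ 2 / K2 := by
    have e : ∑ i, q i ^ 2 = (s / K2) ^ 2 * K2 := by
      rw [hK2, Finset.mul_sum]; exact Finset.sum_congr rfl fun i _ => by simp [hq]; ring
    rw [e]; field_simp
  have hP : ∑ i, p i ^ 2 = (∑ i, x i ^ 2) - s ^ 2 / K2 := by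
    have e : ∑ i, p i ^ 2 = (∑ i, x i ^ 2) - 2 * (s / K2) * s + (s / K2) ^ 2 * K2 := by
      rw [hs, hK2, Finset.mul_sum, Finset.mul_sum, ← Finset.sum_sub_distrib, ← Finset.sum_add_distrib]
      exact Finset.sum_congr rfl fun i _ => by simp [hp, hq]; ring
    rw [e]; field_simp; ring
  -- expansion of the symbol
  have hexp : symb 𝔸 k x = bsymb 𝔸 k p p + bsymb 𝔸 k p q + bsymb 𝔸 k q p + bsymb 𝔸 k q q := by
    rw [symb_eq_bsymb, hxpq, bsymb_add_mid, bsymb_add_right', bsymb_add_right']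
    ring
  -- the four pieces
  have h1 : lo * (K2 * ∑ i, p i ^ 2) ≤ bsymb 𝔸 k p p := by
    have := (hN k p hptrans).1
    rwa [symb_eq_bsymb] at this
  set P : ℝ := Real.sqrt (∑ i, p i ^ 2) with hPdef
  set Q : ℝ := Real.sqrt (∑ i, q i ^ 2) with hQdef
  have hP0 : 0 ≤ P := Real.sqrt_nonneg _
  have hQ0 : 0 ≤ Q := Real.sqrt_nonneg _
  have hPP : P * P = ∑ i, p i ^ 2 := Real.mul_self_sqrt (Finset.sum_nonneg fun _ _ => sq_nonneg _)
  have hQQ : Q * Q = ∑ i, q i ^ 2 := Real.mul_self_sqrt (Finset.sum_nonneg fun _ _ => sq_nonneg _)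
  have h2 : -(h * K2 * (P * Q)) ≤ bsymb 𝔸 k p q := neg_le_of_abs_le (abs_bsymb_le_of_fullBound hB k p q)
  have h3 : -(h * K2 * (Q * P)) ≤ bsymb 𝔸 k q p := neg_le_of_abs_le (abs_bsymb_le_of_fullBound hB k q p)
  have h4 : -(h * K2 * (Q * Q)) ≤ bsymb 𝔸 k q q := neg_le_of_abs_le (abs_bsymb_le_of_fullBound hB k q q)
  -- Young: `2 h P Q ≤ η P² + (h²/η) Q²`
  have hY : 2 * h * (P * Q) ≤ η * (P * P) + h ^ 2 / η * (Q * Q) := by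
    have hsq : 0 ≤ (η * P - h * Q) ^ 2 / η := by positivity
    have e : (η * P - h * Q) ^ 2 / η = η * (P * P) + h ^ 2 / η * (Q * Q) - 2 * h * (P * Q) := by
      field_simp; ring
    linarith [hsq, e]
  -- assemble
  have hK2Q : K2 * (Q * Q) = s ^ 2 := by rw [hQQ, hQ]; field_simp
  calc (lo - η) * (K2 * ∑ i, x i ^ 2) - (lo - η + h + h ^ 2 / η) * s ^ 2
      = (lo - η) * (K2 * (P * P)) - (h + h ^ 2 / η) * (K2 * (Q * Q)) := by
        rw [hPP, hP, hK2Q]; field_simp; ring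
    _ = lo * (K2 * (P * P)) - K2 * (η * (P * P) + h ^ 2 / η * (Q * Q)) - h * K2 * (Q * Q) := by ring
    _ ≤ lo * (K2 * (P * P)) - K2 * (2 * h * (P * Q)) - h * K2 * (Q * Q) := by
        nlinarith [mul_le_mul_of_nonneg_left hY hK2nn]
    _ ≤ bsymb 𝔸 k p p + bsymb 𝔸 k p q + bsymb 𝔸 k q p + bsymb 𝔸 k q q := by rw [← hPP] at h1; linarith
    _ = symb 𝔸 k x := hexp.symm

omit [DecidableEq d] in
/-- Reordering of a fourfold finite sum: the pair `(j, b)` moved outside. [folklore] -/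
private theorem sum_comm_four₃₃ (F : d → d → d → d → ℝ) :
    ∑ i, ∑ a, ∑ j, ∑ b, F i a j b = ∑ j, ∑ b, ∑ i, ∑ a, F i a j b := by
  calc ∑ i, ∑ a, ∑ j, ∑ b, F i a j b = ∑ i, ∑ j, ∑ a, ∑ b, F i a j b :=
        Finset.sum_congr rfl fun i _ => Finset.sum_comm
    _ = ∑ j, ∑ i, ∑ a, ∑ b, F i a j b := Finset.sum_comm
    _ = ∑ j, ∑ i, ∑ b, ∑ a, F i a j b :=
        Finset.sum_congr rfl fun j _ => Finset.sum_congr rfl fun i _ => Finset.sum_comm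
    _ = ∑ j, ∑ b, ∑ i, ∑ a, F i a j b := Finset.sum_congr rfl fun j _ => Finset.sum_comm

/-- The full bound passes to the major transpose. [cite: Giaquinta1983MultipleIntegrals, Ch. III §2 eq. (2.1)] -/
theorem fullBound_majorTranspose {𝔸 : Visc4 d} {h : ℝ} (hB : FullBound 𝔸 h) : FullBound (majorTranspose 𝔸) h := by
  intro ξ ζ
  have e : ∑ i, ∑ a, ∑ j, ∑ b, majorTranspose 𝔸 i a j b * ξ i a * ζ j b =
      ∑ i, ∑ a, ∑ j, ∑ b, 𝔸 i a j b * ζ i a * ξ j b := by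
    simp only [majorTranspose]
    rw [sum_comm_four₃₃ (fun i a j b => 𝔸 j b i a * ξ i a * ζ j b)]
    exact Finset.sum_congr rfl fun j _ => Finset.sum_congr rfl fun b _ => Finset.sum_congr rfl fun i _ =>
      Finset.sum_congr rfl fun a _ => by ring
  rw [e, mul_right_comm]
  exact hB ζ ξ

/-- **The modewise Gårding inequality with divergence (complex Fourier amplitudes)**:
`(lo − η)|k|²‖z‖² − (lo − η + h + h²/η)|Σ_j k_j z_j|² ≤ Re⟪z, T_𝔸(k) z⟫`.
[cite: Giaquinta1983MultipleIntegrals, Ch. III §2 eq. (2.2)–(2.6)] [cite: Frisch1995Turbulence, §9.6.3 eq. (9.57) p. 233] -/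
theorem re_inner_symbT_ge_of_nearIso_fullBound {𝔸 : Visc4 d} {lo hi h η : ℝ} (hN : NearIso 𝔸 lo hi)
    (hB : FullBound 𝔸 h) (hη : 0 < η) (k : d → ℤ) (z : EuclideanSpace ℂ d) :
    (lo - η) * (FunctionSpaces.Torus.freqNormSq k * ‖z‖ ^ 2) -
        (lo - η + h + h ^ 2 / η) * ‖∑ j, (k j : ℂ) * z j‖ ^ 2 ≤ (⟪z, symbT 𝔸 k z⟫_ℂ).re := by
  have hre := symb_ge_of_nearIso_fullBound hN hB hη (fun a => (k a : ℝ)) (fun i => (z i).re)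
  have him := symb_ge_of_nearIso_fullBound hN hB hη (fun a => (k a : ℝ)) (fun i => (z i).im)
  have hnorm : ‖z‖ ^ 2 = ∑ i, (z i).re ^ 2 + ∑ i, (z i).im ^ 2 := by
    rw [EuclideanSpace.norm_sq_eq, ← Finset.sum_add_distrib]
    refine Finset.sum_congr rfl fun i _ => ?_
    rw [Complex.sq_norm, Complex.normSq_apply]
    ring
  have hdot : ‖∑ j, (k j : ℂ) * z j‖ ^ 2 = (∑ i, (z i).re * (k i : ℝ)) ^ 2 + (∑ i, (z i).im * (k i : ℝ)) ^ 2 := by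
    rw [Complex.sq_norm, Complex.normSq_apply, Complex.re_sum, Complex.im_sum]
    have e1 : ∑ j, ((k j : ℂ) * z j).re = ∑ i, (z i).re * (k i : ℝ) :=
      Finset.sum_congr rfl fun j _ => by simp [Complex.mul_re]; ring
    have e2 : ∑ j, ((k j : ℂ) * z j).im = ∑ i, (z i).im * (k i : ℝ) :=
      Finset.sum_congr rfl fun j _ => by simp [Complex.mul_im]; ring
    rw [e1, e2]; ring
  rw [re_inner_symbT_eq, hnorm, hdot, FunctionSpaces.Torus.freqNormSq]
  nlinarith [hre, him]

end Modewise

/-! ## §2 The divergence on the Fourier side -/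

section Divergence

/-- **Fourier coefficients of the divergence**: `(∇·ψ)^(k) = 2πi Σ_j k_j ψ̂_j(k)` for smooth `ψ`.
[cite: Grafakos2014, Prop. 3.2.6 (8)] -/
theorem mFourierCoeff_ofReal_divergence {ψ : UnitAddTorus d → EuclideanSpace ℝ d}
    (hψ : FunctionSpaces.Torus.IsSmooth ψ) (k : d → ℤ) :
    mFourierCoeff (fun x => (FunctionSpaces.Torus.divergence ψ x : ℂ)) k =
      (2 * Real.pi * Complex.I) * ∑ j, (k j : ℂ) * mFourierCoeff (FunctionSpaces.EuclideanSpace.complexify ∘ ψ) k j := by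
  have hsm : ∀ j, FunctionSpaces.Torus.IsSmooth (fun y => (ψ y j : ℂ)) := fun j => (hψ.apply j).ofReal_comp
  have e1 : (fun x => (FunctionSpaces.Torus.divergence ψ x : ℂ)) =
      fun x => ∑ j, FunctionSpaces.Torus.partialDeriv j (fun y => (ψ y j : ℂ)) x := by
    funext x
    unfold FunctionSpaces.Torus.divergence
    push_cast
    exact Finset.sum_congr rfl fun j _ => (FunctionSpaces.Torus.partialDeriv_ofReal_comp (hψ.apply j) j x).symm
  rw [e1, FunctionSpaces.Torus.mFourierCoeff_finset_sum _ (fun j _ => ((hsm j).partialDeriv j).integrable), Finset.mul_sum]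
  refine Finset.sum_congr rfl fun j _ => ?_
  rw [FunctionSpaces.Torus.mFourierCoeff_partialDeriv (hsm j) j k,
    FunctionSpaces.Torus.mFourierCoeff_complexify_apply hψ.integrable, smul_eq_mul]
  ring

/-- **Parseval for the divergence**: `Σ_k 4π² |Σ_j k_j ψ̂_j(k)|² = ∫ (∇·ψ)²`. [cite: Grafakos2014, Prop. 3.2.7 (3)] -/
theorem hasSum_sq_divergence {ψ : UnitAddTorus d → EuclideanSpace ℝ d} (hψ : FunctionSpaces.Torus.IsSmooth ψ) :
    HasSum (fun k : d → ℤ => 4 * Real.pi ^ 2 *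
        ‖∑ j, (k j : ℂ) * mFourierCoeff (FunctionSpaces.EuclideanSpace.complexify ∘ ψ) k j‖ ^ 2)
      (∫ x, FunctionSpaces.Torus.divergence ψ x ^ 2) := by
  have hmem : MemLp (FunctionSpaces.Torus.divergence ψ) 2 volume := hψ.divergence.memLp 2
  have h := FunctionSpaces.Torus.hasSum_sq_norm_mFourierCoeff_ofReal hmem
  refine h.congr_fun fun k => ?_
  rw [mFourierCoeff_ofReal_divergence hψ k, norm_mul, mul_pow]
  congr 1
  have e : ‖(2 * (Real.pi : ℂ) * Complex.I)‖ = 2 * Real.pi := by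
    rw [norm_mul, Complex.norm_I, mul_one, show (2 * (Real.pi : ℂ)) = ((2 * Real.pi : ℝ) : ℂ) by push_cast; ring,
      Complex.norm_real, Real.norm_eq_abs, abs_of_nonneg (by positivity)]
  rw [e]; ring

/-- Bessel form: every truncated divergence sum is bounded by `∫ (∇·ψ)²`. [cite: Grafakos2014, Prop. 3.2.7 (3)] -/
theorem sum_sq_divergence_le {ψ : UnitAddTorus d → EuclideanSpace ℝ d} (hψ : FunctionSpaces.Torus.IsSmooth ψ)
    (S : Finset (d → ℤ)) :
    ∑ k ∈ S, 4 * Real.pi ^ 2 * ‖∑ j, (k j : ℂ) * mFourierCoeff (FunctionSpaces.EuclideanSpace.complexify ∘ ψ) k j‖ ^ 2 ≤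
      ∫ x, FunctionSpaces.Torus.divergence ψ x ^ 2 :=
  sum_le_hasSum S (fun k _ => by positivity) (hasSum_sq_divergence hψ)

end Divergence

/-! ## §3 Gårding's inequality with divergence -/

section Garding

/-- **Gårding's inequality WITH DIVERGENCE for a constant Legendre–Hadamard tensor.**  For
`NearIso 𝔸 lo hi`, `FullBound 𝔸 h`, `0 < η ≤ lo` and every smooth `ψ` (NOT assumed divergence free),
`∫ ⟪ψ, 𝓛_𝔸^* ψ⟫ ≤ −(lo − η)‖∇ψ‖₂² + (lo − η + h + h²/η) ∫ (∇·ψ)²`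
(the modewise inequality `re_inner_symbT_ge_of_nearIso_fullBound` summed by Parseval, as in the tree's
divergence-free `integral_inner_viscAdj_self_le`; Giaquinta (2.2) ⇒ (2.6) with the longitudinal part kept).
[cite: Giaquinta1983MultipleIntegrals, Ch. III §2 eq. (2.2)–(2.6)] [cite: Frisch1995Turbulence, §9.6.3 eq. (9.57) p. 233] -/
theorem integral_inner_viscAdj_self_le_add_sq_divergence {𝔸 : Visc4 d} {lo hi h η : ℝ} (h𝔸 : NearIso 𝔸 lo hi)
    (hB : FullBound 𝔸 h) (hh : 0 ≤ h) (hη : 0 < η) (hηlo : η ≤ lo)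
    {ψ : UnitAddTorus d → EuclideanSpace ℝ d} (hψ : FunctionSpaces.Torus.IsSmooth ψ) :
    ∫ x, ⟪ψ x, viscAdj 𝔸 ψ x⟫_ℝ ≤
      -((lo - η) * FunctionSpaces.Torus.gradNormSq ψ) +
        (lo - η + h + h ^ 2 / η) * ∫ x, FunctionSpaces.Torus.divergence ψ x ^ 2 := by
  have hψi : Integrable ψ volume := hψ.integrable
  have hψ2 : MemLp ψ 2 volume := hψ.memLp 2
  have hV : FunctionSpaces.Torus.IsSmooth (viscAdj 𝔸 ψ) := isSmooth_viscAdj 𝔸 hψ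
  have hV2 : MemLp (viscAdj 𝔸 ψ) 2 volume := hV.memLp 2
  have h𝔸T : NearIso (majorTranspose 𝔸) lo hi := (nearIso_majorTranspose_iff 𝔸 lo hi).2 h𝔸
  have hBT : FullBound (majorTranspose 𝔸) h := fullBound_majorTranspose hB
  obtain ⟨C, hC⟩ : ∃ C : ℝ, C = lo - η + h + h ^ 2 / η := ⟨_, rfl⟩
  have hC0 : 0 ≤ C := by
    have : 0 ≤ h ^ 2 / η := by positivity
    rw [hC]; linarith
  rw [← hC]
  obtain ⟨c, hc⟩ : ∃ c : (d → ℤ) → EuclideanSpace ℂ d,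
      ∀ k, mFourierCoeff (FunctionSpaces.EuclideanSpace.complexify ∘ ψ) k = c k := ⟨_, fun _ => rfl⟩
  obtain ⟨Dv, hDv⟩ : ∃ Dv : ℝ, ∫ x, FunctionSpaces.Torus.divergence ψ x ^ 2 = Dv := ⟨_, rfl⟩
  rw [hDv]
  -- the truncated pairings
  have hN : ∀ N : ℕ, ∫ x, ⟪FunctionSpaces.Torus.fourierTruncate N ψ x, viscAdj 𝔸 ψ x⟫_ℝ ≤
      -((lo - η) * FunctionSpaces.Torus.gradNormSq (FunctionSpaces.Torus.fourierTruncate N ψ)) + C * Dv := by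
    intro N
    have hdivN := sum_sq_divergence_le hψ (FunctionSpaces.Torus.freqBall N)
    simp only [hc, hDv] at hdivN
    rw [integral_inner_fourierTruncate_viscAdj_eq 𝔸 hψ N, gradNormSq_fourierTruncate,
      FunctionSpaces.Torus.fourierTruncate_eq,
      FunctionSpaces.Torus.toReal_eGradNormSq_realTrigPoly FunctionSpaces.Torus.neg_mem_freqBall_of_mem
        (FunctionSpaces.Torus.isConjSymm_mFourierCoeff hψi)]
    simp only [hc]
    -- modewise
    have hmode : ∀ k ∈ FunctionSpaces.Torus.freqBall N,
        ((-(4 * Real.pi ^ 2 : ℝ) : ℂ) * ⟪c k, symbT (majorTranspose 𝔸) k (c k)⟫_ℂ).re ≤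
          -(4 * Real.pi ^ 2 * ((lo - η) * (FunctionSpaces.Torus.freqNormSq k * ‖c k‖ ^ 2))) +
            C * (4 * Real.pi ^ 2 * ‖∑ j, (k j : ℂ) * c k j‖ ^ 2) := by
      intro k _
      rw [neg_mul, Complex.neg_re, Complex.re_ofReal_mul]
      have h := mul_le_mul_of_nonneg_left (re_inner_symbT_ge_of_nearIso_fullBound h𝔸T hBT hη k (c k))
        (by positivity : (0 : ℝ) ≤ 4 * Real.pi ^ 2)
      rw [hC]
      nlinarith [h]
    refine (Finset.sum_le_sum hmode).trans ?_
    have e : ∑ k ∈ FunctionSpaces.Torus.freqBall N,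
        (-(4 * Real.pi ^ 2 * ((lo - η) * (FunctionSpaces.Torus.freqNormSq k * ‖c k‖ ^ 2))) +
          C * (4 * Real.pi ^ 2 * ‖∑ j, (k j : ℂ) * c k j‖ ^ 2)) =
        -((lo - η) * (4 * Real.pi ^ 2 * ∑ k ∈ FunctionSpaces.Torus.freqBall N, FunctionSpaces.Torus.freqNormSq k * ‖c k‖ ^ 2)) +
          C * ∑ k ∈ FunctionSpaces.Torus.freqBall N, 4 * Real.pi ^ 2 * ‖∑ j, (k j : ℂ) * c k j‖ ^ 2 := by
      have e1 : ∑ k ∈ FunctionSpaces.Torus.freqBall N,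
          -(4 * Real.pi ^ 2 * ((lo - η) * (FunctionSpaces.Torus.freqNormSq k * ‖c k‖ ^ 2))) =
          -((lo - η) * (4 * Real.pi ^ 2 * ∑ k ∈ FunctionSpaces.Torus.freqBall N, FunctionSpaces.Torus.freqNormSq k * ‖c k‖ ^ 2)) := by
        rw [Finset.sum_neg_distrib, Finset.mul_sum, Finset.mul_sum]
        congr 1
        exact Finset.sum_congr rfl fun k _ => by ring
      have e2 : ∑ k ∈ FunctionSpaces.Torus.freqBall N, C * (4 * Real.pi ^ 2 * ‖∑ j, (k j : ℂ) * c k j‖ ^ 2) =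
          C * ∑ k ∈ FunctionSpaces.Torus.freqBall N, 4 * Real.pi ^ 2 * ‖∑ j, (k j : ℂ) * c k j‖ ^ 2 := by
        rw [Finset.mul_sum]
      rw [Finset.sum_add_distrib, e1, e2]
    rw [e]
    have := mul_le_mul_of_nonneg_left hdivN hC0
    linarith
  -- limits `N → ∞`
  have hlim1 : Tendsto (fun N : ℕ => ∫ x, ⟪FunctionSpaces.Torus.fourierTruncate N ψ x, viscAdj 𝔸 ψ x⟫_ℝ) atTop
      (𝓝 (∫ x, ⟪ψ x, viscAdj 𝔸 ψ x⟫_ℝ)) := by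
    have h := (FunctionSpaces.Torus.hasSum_re_inner_mFourierCoeff_complexify hψ2 hV2).comp
      FunctionSpaces.Torus.tendsto_freqBall_atTop
    refine h.congr fun N => ?_
    rw [Function.comp_apply, FunctionSpaces.Torus.integral_inner_fourierTruncate_left hψi hV2 N]
  have hlim2 : Tendsto (fun N : ℕ => -((lo - η) * FunctionSpaces.Torus.gradNormSq (FunctionSpaces.Torus.fourierTruncate N ψ)) + C * Dv)
      atTop (𝓝 (-((lo - η) * FunctionSpaces.Torus.gradNormSq ψ) + C * Dv)) :=
    (((FunctionSpaces.Torus.tendsto_gradNormSq_fourierTruncate hψ).const_mul (lo - η)).neg).add_const _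
  exact le_of_tendsto_of_tendsto' hlim1 hlim2 hN

end Garding

/-! ## §4 `G`-solenoidal fields: the divergence is `O(θ)` in `Ḣ¹` (Piola) -/

section Solenoidal

variable {G : UnitAddTorus d → Matrix d d ℝ} {ψ : UnitAddTorus d → EuclideanSpace ℝ d}

/-- **The divergence of a `G`-solenoidal field**: if the columns of `G` are divergence free (Piola) and
`∇·(Gψ) = 0`, then `∇·ψ = −Σ_{i,c} (G − 1)_{ci} ∂_c ψ_i` pointwise (test-side Piola
`Σ_{i,c} G_{ci}∂_cψ_i = 0`). [cite: Evans2010, §8.1.4.b] [cite: ArmstrongVicol2025, §4.1 (s_{m−1}, T_{m−1}), PDF p. 34] -/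
theorem divergence_eq_neg_sum_of_isDivFree_distort (hGs : ∀ c a, FunctionSpaces.Torus.IsSmooth (fun y => G y c a))
    (hGp : ∀ a, FunctionSpaces.Torus.IsDivFree (fun y => (WithLp.toLp 2 fun c => G y c a : EuclideanSpace ℝ d)))
    (hψ : FunctionSpaces.Torus.IsSmooth ψ) (hdiv : FunctionSpaces.Torus.IsDivFree (distort G ψ)) (y : UnitAddTorus d) :
    FunctionSpaces.Torus.divergence ψ y =
      -∑ i, ∑ c, (G y c i - (1 : Matrix d d ℝ) c i) * FunctionSpaces.Torus.partialDeriv c ψ y i := by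
  have hP := sum_mul_partialDeriv_eq_zero_of_isDivFree_distort hGs hGp hψ hdiv y
  have hdivψ : FunctionSpaces.Torus.divergence ψ y = ∑ i, FunctionSpaces.Torus.partialDeriv i ψ y i := by
    unfold FunctionSpaces.Torus.divergence
    exact Finset.sum_congr rfl fun i _ => by
      rw [FunctionSpaces.Torus.partialDeriv_apply_coord (hψ.isContDiff (by simp)) i y i]
  have hone : ∑ i, ∑ c, (1 : Matrix d d ℝ) c i * FunctionSpaces.Torus.partialDeriv c ψ y i =
      ∑ i, FunctionSpaces.Torus.partialDeriv i ψ y i :=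
    Finset.sum_congr rfl fun i _ => by simp [Matrix.one_apply]
  simp only [sub_mul, Finset.sum_sub_distrib, hP, hone, zero_sub, neg_neg, hdivψ]

/-- Pointwise: `(∇·ψ)² ≤ (card d · θ)² Σ_{i,c} (∂_cψ_i)²` for a `G`-solenoidal `ψ` and `|G − 1| ≤ θ`
entrywise (Cauchy–Schwarz over the `d × d` entries). [cite: ArmstrongVicol2025, §4.1 (s_{m−1}, T_{m−1}), PDF p. 34] -/
theorem sq_divergence_le_of_isDivFree_distort (hGs : ∀ c a, FunctionSpaces.Torus.IsSmooth (fun y => G y c a))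
    (hGp : ∀ a, FunctionSpaces.Torus.IsDivFree (fun y => (WithLp.toLp 2 fun c => G y c a : EuclideanSpace ℝ d)))
    (hψ : FunctionSpaces.Torus.IsSmooth ψ) (hdiv : FunctionSpaces.Torus.IsDivFree (distort G ψ))
    {θ : ℝ} (hG : ∀ y c a, |G y c a - (1 : Matrix d d ℝ) c a| ≤ θ) (y : UnitAddTorus d) :
    FunctionSpaces.Torus.divergence ψ y ^ 2 ≤
      (Fintype.card d * θ) ^ 2 * ∑ i, ∑ c, FunctionSpaces.Torus.partialDeriv c ψ y i ^ 2 := by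
  set a : d → d → ℝ := fun i c => |FunctionSpaces.Torus.partialDeriv c ψ y i| with ha
  have h1 : |FunctionSpaces.Torus.divergence ψ y| ≤ θ * ∑ i, ∑ c, a i c := by
    rw [divergence_eq_neg_sum_of_isDivFree_distort hGs hGp hψ hdiv y, abs_neg]
    refine (Finset.abs_sum_le_sum_abs _ _).trans ?_
    rw [Finset.mul_sum]
    refine Finset.sum_le_sum fun i _ => (Finset.abs_sum_le_sum_abs _ _).trans ?_
    rw [Finset.mul_sum]
    refine Finset.sum_le_sum fun c _ => ?_
    rw [abs_mul]
    exact mul_le_mul_of_nonneg_right (hG y c i) (abs_nonneg _)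
  -- Cauchy–Schwarz twice
  have h2 : (∑ i, ∑ c, a i c) ^ 2 ≤ Fintype.card d * ∑ i, (∑ c, a i c) ^ 2 := by
    have h := sq_sum_le_card_mul_sum_sq (s := (Finset.univ : Finset d)) (f := fun i => ∑ c, a i c)
    simpa only [Finset.card_univ] using h
  have h3 : ∀ i, (∑ c, a i c) ^ 2 ≤ Fintype.card d * ∑ c, a i c ^ 2 := fun i => by
    have h := sq_sum_le_card_mul_sum_sq (s := (Finset.univ : Finset d)) (f := fun c => a i c)
    simpa only [Finset.card_univ] using h
  have h4 : (∑ i, ∑ c, a i c) ^ 2 ≤ (Fintype.card d : ℝ) ^ 2 * ∑ i, ∑ c, FunctionSpaces.Torus.partialDeriv c ψ y i ^ 2 := by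
    calc (∑ i, ∑ c, a i c) ^ 2 ≤ Fintype.card d * ∑ i, (∑ c, a i c) ^ 2 := h2
      _ ≤ Fintype.card d * ∑ i, (Fintype.card d * ∑ c, a i c ^ 2) :=
          mul_le_mul_of_nonneg_left (Finset.sum_le_sum fun i _ => h3 i) (Nat.cast_nonneg _)
      _ = (Fintype.card d : ℝ) ^ 2 * ∑ i, ∑ c, FunctionSpaces.Torus.partialDeriv c ψ y i ^ 2 := by
          rw [← Finset.mul_sum]
          simp only [ha, sq_abs]
          ring
  have h5 : FunctionSpaces.Torus.divergence ψ y ^ 2 ≤ (θ * ∑ i, ∑ c, a i c) ^ 2 := by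
    rw [← sq_abs (FunctionSpaces.Torus.divergence ψ y)]
    exact pow_le_pow_left₀ (abs_nonneg _) h1 2
  calc FunctionSpaces.Torus.divergence ψ y ^ 2 ≤ (θ * ∑ i, ∑ c, a i c) ^ 2 := h5
    _ = θ ^ 2 * (∑ i, ∑ c, a i c) ^ 2 := by ring
    _ ≤ θ ^ 2 * ((Fintype.card d : ℝ) ^ 2 * ∑ i, ∑ c, FunctionSpaces.Torus.partialDeriv c ψ y i ^ 2) :=
        mul_le_mul_of_nonneg_left h4 (sq_nonneg _)
    _ = (Fintype.card d * θ) ^ 2 * ∑ i, ∑ c, FunctionSpaces.Torus.partialDeriv c ψ y i ^ 2 := by ring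

omit [DecidableEq d] in
/-- Continuity of `y ↦ Σ_{i,c} (∂_cψ(y))_i²` for smooth `ψ`. [cite: Giaquinta1983MultipleIntegrals, Ch. III §2 eq. (2.2)] -/
theorem continuous_sum_sum_sq_partialDeriv [DecidableEq d] (hψ : FunctionSpaces.Torus.IsSmooth ψ) :
    Continuous fun y => ∑ i, ∑ c, FunctionSpaces.Torus.partialDeriv c ψ y i ^ 2 :=
  continuous_finsetSum _ fun i _ => continuous_finsetSum _ fun c _ =>
    (((EuclideanSpace.proj i : EuclideanSpace ℝ d →L[ℝ] ℝ).continuous.comp (hψ.partialDeriv c).continuous).pow 2)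

/-- **`∫ (∇·ψ)² ≤ (card d · θ)² ‖∇ψ‖₂²`** for a smooth `G`-solenoidal `ψ`, `G` with divergence-free columns and
`|G − 1| ≤ θ` entrywise. [cite: ArmstrongVicol2025, §4.1 (s_{m−1}, T_{m−1}), PDF p. 34] -/
theorem integral_sq_divergence_le_of_isDivFree_distort (hGs : ∀ c a, FunctionSpaces.Torus.IsSmooth (fun y => G y c a))
    (hGp : ∀ a, FunctionSpaces.Torus.IsDivFree (fun y => (WithLp.toLp 2 fun c => G y c a : EuclideanSpace ℝ d)))
    (hψ : FunctionSpaces.Torus.IsSmooth ψ) (hdiv : FunctionSpaces.Torus.IsDivFree (distort G ψ))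
    {θ : ℝ} (hG : ∀ y c a, |G y c a - (1 : Matrix d d ℝ) c a| ≤ θ) :
    ∫ x, FunctionSpaces.Torus.divergence ψ x ^ 2 ≤ (Fintype.card d * θ) ^ 2 * FunctionSpaces.Torus.gradNormSq ψ := by
  rw [gradNormSq_eq_integral_sum_sum_sq, ← integral_const_mul]
  refine integral_mono ((hψ.divergence.continuous.pow 2).integrable_unitAddTorus)
    (((continuous_sum_sum_sq_partialDeriv hψ).const_mul _).integrable_unitAddTorus) fun y => ?_
  exact sq_divergence_le_of_isDivFree_distort hGs hGp hψ hdiv hG y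

/-- **Gårding's inequality on `G`-solenoidal fields (flat tensor).**  For `NearIso 𝔸 lo hi`, `FullBound 𝔸 h`,
`0 < η ≤ lo`, a frame `G` with smooth entries, divergence-free columns and `|G − 1| ≤ θ` entrywise, and a
smooth `ψ` with `∇·(Gψ) = 0`:
`∫ ⟪ψ, 𝓛_𝔸^* ψ⟫ ≤ −(lo − η − (lo − η + h + h²/η)(card d · θ)²) ‖∇ψ‖₂²`.
[cite: Giaquinta1983MultipleIntegrals, Ch. III §2 eq. (2.2)–(2.6)] [cite: ArmstrongVicol2025, §4.1 (s_{m−1}, T_{m−1}), PDF p. 34] -/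
theorem integral_inner_viscAdj_self_le_of_isDivFree_distort {𝔸 : Visc4 d} {lo hi h η : ℝ} (h𝔸 : NearIso 𝔸 lo hi)
    (hB : FullBound 𝔸 h) (hh : 0 ≤ h) (hη : 0 < η) (hηlo : η ≤ lo)
    (hGs : ∀ c a, FunctionSpaces.Torus.IsSmooth (fun y => G y c a))
    (hGp : ∀ a, FunctionSpaces.Torus.IsDivFree (fun y => (WithLp.toLp 2 fun c => G y c a : EuclideanSpace ℝ d)))
    (hψ : FunctionSpaces.Torus.IsSmooth ψ) (hdiv : FunctionSpaces.Torus.IsDivFree (distort G ψ))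
    {θ : ℝ} (hG : ∀ y c a, |G y c a - (1 : Matrix d d ℝ) c a| ≤ θ) :
    ∫ x, ⟪ψ x, viscAdj 𝔸 ψ x⟫_ℝ ≤
      -((lo - η - (lo - η + h + h ^ 2 / η) * (Fintype.card d * θ) ^ 2) * FunctionSpaces.Torus.gradNormSq ψ) := by
  have h1 := integral_inner_viscAdj_self_le_add_sq_divergence h𝔸 hB hh hη hηlo hψ
  have h2 := integral_sq_divergence_le_of_isDivFree_distort hGs hGp hψ hdiv hG
  have hC0 : 0 ≤ lo - η + h + h ^ 2 / η := by
    have : 0 ≤ h ^ 2 / η := by positivity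
    linarith
  nlinarith [mul_le_mul_of_nonneg_left h2 hC0]

end Solenoidal

/-! ## §5 The twisted Gårding inequality on `G`-solenoidal fields -/

section Twisted

variable {G : UnitAddTorus d → Matrix d d ℝ} {ψ : UnitAddTorus d → EuclideanSpace ℝ d}

omit [DecidableEq d] in
/-- Continuity of the energy-form density `y ↦ E_{𝔹(y)}(ξ(y))` for continuous coefficient and gradient fields.
[cite: Giaquinta1983MultipleIntegrals, Ch. III §2 eq. (2.3)] -/
theorem continuous_gradForm_field {𝔹 : UnitAddTorus d → Visc4 d} {ξ : UnitAddTorus d → d → d → ℝ}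
    (h𝔹 : ∀ i a j b, Continuous fun y => 𝔹 y i a j b) (hξ : ∀ i a, Continuous fun y => ξ y i a) :
    Continuous fun y => gradForm (𝔹 y) (ξ y) := by
  unfold gradForm
  exact continuous_finsetSum _ fun i _ => continuous_finsetSum _ fun a _ => continuous_finsetSum _ fun j _ =>
    continuous_finsetSum _ fun b _ => ((h𝔹 i a j b).mul (hξ i a)).mul (hξ j b)

/-- The flat viscous pairing is minus the integrated energy form: `∫ ⟪ψ, 𝓛_𝔸^* ψ⟫ = −∫ E_𝔸(∇ψ)` (the
constant-coefficient case of the tree's `integral_inner_viscAdjVar_self_eq_neg_gradForm`).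
[cite: Giaquinta1983MultipleIntegrals, Ch. III §2 eq. (2.3)] -/
theorem integral_inner_viscAdj_self_eq_neg_gradForm (𝔸 : Visc4 d) (hψ : FunctionSpaces.Torus.IsSmooth ψ) :
    ∫ x, ⟪ψ x, viscAdj 𝔸 ψ x⟫_ℝ = -∫ x, gradForm 𝔸 (fun i c => (FunctionSpaces.Torus.partialDeriv c ψ x) i) := by
  have h := integral_inner_viscAdjVar_self_eq_neg_gradForm (𝔹 := fun _ : UnitAddTorus d => 𝔸)
    (fun i c j e => FunctionSpaces.Torus.isSmooth_const _) hψ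
  rw [← h]
  refine integral_congr_ae (ae_of_all _ fun x => ?_)
  dsimp only
  rw [viscAdjVar_const 𝔸 hψ x]

/-- **Integrated tensor comparison**: `∫ E_{𝔸^{G}}(∇ψ) ≥ ∫ E_𝔸(∇ψ) − h(2dθ + (dθ)²)‖∇ψ‖₂²` for `|G − 1| ≤ θ`
entrywise (the pointwise `abs_gradForm_conj_sub_le`, integrated). [cite: Giaquinta1983MultipleIntegrals, Ch. III §2 eq. (2.2)]
[cite: ArmstrongVicol2025, §4.1 (s_{m−1}, T_{m−1}), PDF p. 34] -/
theorem integral_gradForm_sub_le_integral_gradForm_conj {𝔸 : Visc4 d} {h : ℝ} (hB : FullBound 𝔸 h) (hh : 0 ≤ h)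
    (hGs : ∀ c a, FunctionSpaces.Torus.IsSmooth (fun y => G y c a)) (hψ : FunctionSpaces.Torus.IsSmooth ψ)
    {θ : ℝ} (hθ : 0 ≤ θ) (hG : ∀ y c a, |G y c a - (1 : Matrix d d ℝ) c a| ≤ θ) :
    (∫ x, gradForm 𝔸 (fun i c => (FunctionSpaces.Torus.partialDeriv c ψ x) i)) -
        h * (2 * (Fintype.card d * θ) + (Fintype.card d * θ) ^ 2) * FunctionSpaces.Torus.gradNormSq ψ ≤
      ∫ x, gradForm (Visc4.conj (G x) 𝔸) (fun i c => (FunctionSpaces.Torus.partialDeriv c ψ x) i) := by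
  have hξc : ∀ i a, Continuous fun y => (FunctionSpaces.Torus.partialDeriv a ψ y) i := fun i a =>
    (EuclideanSpace.proj i : EuclideanSpace ℝ d →L[ℝ] ℝ).continuous.comp (hψ.partialDeriv a).continuous
  have hcG : Continuous fun x => gradForm (Visc4.conj (G x) 𝔸) (fun i c => (FunctionSpaces.Torus.partialDeriv c ψ x) i) :=
    continuous_gradForm_field (fun i a j b => (isSmooth_conj_entry hGs 𝔸 i a j b).continuous) hξc
  have hc1 : Continuous fun x => gradForm 𝔸 (fun i c => (FunctionSpaces.Torus.partialDeriv c ψ x) i) :=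
    continuous_gradForm_field (fun _ _ _ _ => continuous_const) hξc
  have hc2 : Continuous fun x => ∑ i, ∑ c, FunctionSpaces.Torus.partialDeriv c ψ x i ^ 2 :=
    continuous_sum_sum_sq_partialDeriv hψ
  have hpt : ∀ x, gradForm 𝔸 (fun i c => (FunctionSpaces.Torus.partialDeriv c ψ x) i) -
      h * (2 * (Fintype.card d * θ) + (Fintype.card d * θ) ^ 2) * ∑ i, ∑ c, FunctionSpaces.Torus.partialDeriv c ψ x i ^ 2 ≤
      gradForm (Visc4.conj (G x) 𝔸) (fun i c => (FunctionSpaces.Torus.partialDeriv c ψ x) i) := by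
    intro x
    have h' := neg_le_of_abs_le (abs_gradForm_conj_sub_le hB hh hθ (hG x)
      (fun i c => (FunctionSpaces.Torus.partialDeriv c ψ x) i))
    linarith
  have hI1 : Integrable (fun x => gradForm 𝔸 (fun i c => (FunctionSpaces.Torus.partialDeriv c ψ x) i) -
      h * (2 * (Fintype.card d * θ) + (Fintype.card d * θ) ^ 2) * ∑ i, ∑ c, FunctionSpaces.Torus.partialDeriv c ψ x i ^ 2)
      volume := (hc1.sub (hc2.const_mul _)).integrable_unitAddTorus
  have hmono : ∫ x, (gradForm 𝔸 (fun i c => (FunctionSpaces.Torus.partialDeriv c ψ x) i) -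
      h * (2 * (Fintype.card d * θ) + (Fintype.card d * θ) ^ 2) * ∑ i, ∑ c, FunctionSpaces.Torus.partialDeriv c ψ x i ^ 2) ≤
      ∫ x, gradForm (Visc4.conj (G x) 𝔸) (fun i c => (FunctionSpaces.Torus.partialDeriv c ψ x) i) :=
    integral_mono hI1 hcG.integrable_unitAddTorus hpt
  rw [integral_sub hc1.integrable_unitAddTorus (hc2.const_mul _).integrable_unitAddTorus, integral_const_mul,
    ← gradNormSq_eq_integral_sum_sum_sq] at hmono
  exact hmono

/-- **THE TWISTED GÅRDING INEQUALITY ON `G`-SOLENOIDAL FIELDS** (usable form of the twisted coercivity (E2)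
with a Legendre–Hadamard tensor).  For `NearIso 𝔸 lo hi`, `FullBound 𝔸 h`, `0 < η ≤ lo`, a frame `G` with
smooth entries, divergence-free columns (Piola) and `|G − 1| ≤ θ` entrywise, and a smooth `ψ` with
`∇·(Gψ) = 0`:
`∫ ⟪ψ, 𝓛^{G,*}_𝔸 ψ⟫ ≤ −(lo − η − (lo − η + h + h²/η)(dθ)² − h(2dθ + (dθ)²)) ‖∇ψ‖₂²`, `d = card d`
(`viscAdjVar (y ↦ 𝔸^{G(y)})`; energy-form identity, the integrated tensor comparison and §4).
[cite: Giaquinta1983MultipleIntegrals, Ch. III §2 eq. (2.2)–(2.6)] [cite: ArmstrongVicol2025, §4.1 (s_{m−1}, T_{m−1}), PDF p. 34] -/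
theorem integral_inner_viscAdjVar_conj_self_le_of_isDivFree_distort {𝔸 : Visc4 d} {lo hi h η : ℝ}
    (h𝔸 : NearIso 𝔸 lo hi) (hB : FullBound 𝔸 h) (hh : 0 ≤ h) (hη : 0 < η) (hηlo : η ≤ lo)
    (hGs : ∀ c a, FunctionSpaces.Torus.IsSmooth (fun y => G y c a))
    (hGp : ∀ a, FunctionSpaces.Torus.IsDivFree (fun y => (WithLp.toLp 2 fun c => G y c a : EuclideanSpace ℝ d)))
    (hψ : FunctionSpaces.Torus.IsSmooth ψ) (hdiv : FunctionSpaces.Torus.IsDivFree (distort G ψ))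
    {θ : ℝ} (hθ : 0 ≤ θ) (hG : ∀ y c a, |G y c a - (1 : Matrix d d ℝ) c a| ≤ θ) :
    ∫ x, ⟪ψ x, viscAdjVar (fun y => Visc4.conj (G y) 𝔸) ψ x⟫_ℝ ≤
      -((lo - η - (lo - η + h + h ^ 2 / η) * (Fintype.card d * θ) ^ 2 -
          h * (2 * (Fintype.card d * θ) + (Fintype.card d * θ) ^ 2)) * FunctionSpaces.Torus.gradNormSq ψ) := by
  have hflat := integral_inner_viscAdj_self_le_of_isDivFree_distort h𝔸 hB hh hη hηlo hGs hGp hψ hdiv hG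
  have hcmp := integral_gradForm_sub_le_integral_gradForm_conj hB hh hGs hψ hθ hG
  rw [integral_inner_viscAdjVar_self_eq_neg_gradForm (fun i c j e => isSmooth_conj_entry hGs 𝔸 i c j e) hψ]
  rw [integral_inner_viscAdj_self_eq_neg_gradForm 𝔸 hψ] at hflat
  linarith

end Twisted

end Torus

end Literature.Analysis.FluidPDE
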